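import Literature.NumberTheory.EllipticCurves.BSDShaProofs
import HarnessLib

/-!
# A non-divisible class of order `p` pins `Ш[p^∞] = Ш[p]` (the kernel side of a second-descent
# `EMPTY` certificate; cell `b2b-bsdres`, CLASS-CLOSURE instrument B-1 `SEL3CT-ALT`, seat cc-eng-4)

HONEST FRAMING (cell `b2b-bsdres`, run/shared/lean/b2b/bsd-rank1-residual/, verbatim in every
file): the goal of the cell is to DELETE the COMBINATION-SHAPED residual classes of the
Birch–Swinnerton-Dyer formula for ALL analytic-rank `≤ 1` elliptic curves over `ℚ` — "full BSD
formula for every rank `≤ 1` curve in class `C`" assembled STRICTLY from published theorems — so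
that the rank-`≤ 1` remainder becomes exactly the CONSTRUCTION-SHAPED classes, which are TYPED
(missing-input `Prop`s), NOT attempted. This is not "finishing BSD". This file is a class-free TOOL
theorem (pure finite-abelian-group algebra + the tree's Cassels–Tate pairing fact); it books
nothing, moves no mark, and is not a Literature fact. THEOREMS ONLY (no definition, no named fact,
no `sorry`).

## What this file does (RUNBOOK §5 of instrument B-1 made a kernel statement)

The second `p`-descent instrument B-1 (Creutz, *Second p-descents on elliptic curves*, Math. Comp.
83 (2014); here `p = 3`) returns, for ONE plane cubic `C` representing a non-zero class
`c ∈ Ш(E/ℚ)[p]`, the verdict `EMPTY` = "`c` is not divisible by `p` in `Ш`". The lane's reading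
(RUNBOOK §5) was: *given* `dim Ш[p] = 2` exactly and the Cassels–Tate alternating pairing,
`EMPTY` on one class pins `#Ш[p^∞] = p²`. This file PROVES that reading:

* `nsmul_eq_zero_of_sq_nsmul_eq_zero_of_alternating` (§1, any finite abelian group `A`, any
  abelian coefficient group, any prime `p`): an alternating bi-additive pairing on `A` with trivial
  kernel, `#A[p] = p²`, and ONE element `c` with `p • c = 0` that is not of the form `p • d`
  ⟹ every `x` with `p² • x = 0` has `p • x = 0` (so `A[p^k] = A[p]` for all `k ≥ 1`;
  `torsionBy_sq_eq_torsionBy_of_alternating`, `card_torsionBy_sq_eq_of_alternating`).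
  Proof (no structure theorem): if some `p`-power-torsion element had order `≥ p²`, take `u` of
  maximal `p`-power order `p^k`, `k ≥ 2`, and `y = p^(k-1) • u ≠ 0`; the subgroup
  `S = {a : p • a = 0, a ∈ pA}` is proper in `A[p]` (it misses `c`) and contains `y`, so
  `S = ℤ∙y` by counting (`#A[p] = p²`); for every `p`-power-torsion `z`, `p^(k-1) • z ∈ S`, hence
  `B y z = B u (p^(k-1) • z) = t • p^(k-1) • B u u = 0`; coprime-order bookkeeping extends
  `B y w = 0` to all `w`, contradicting the trivial kernel.
* `WeierstrassCurve.sha_nsmul_eq_zero_of_sq_of_casselsTate_of_not_divisible` (§2): the same for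
  `A = Ш(E/K)` finite, with the pairing supplied by the tree fact `exists_casselsTate_pairing`
  (Silverman *AEC* X.4.14; kernel = divisible elements = `⊥` for finite `Ш`,
  `divisibleElements_eq_bot_of_finite`), and `card_sha_torsionBy_sq_eq_of_casselsTate_of_not_divisible`:
  `#Ш[p²] = p²` — the input `#Ш[9] = #Ш[3]` that turns the descent count
  `#Sel^(9) = 9^r · #E(ℚ)[9] · #Ш[9]` into the `#Sel^(9) = 81` hypothesis of
  `X11b/Three/NineDescentCertificate.lean` on the `#Ш_an = 9` rows, and the 'h9' binder of the
  B-1 EMPTY-direction records (N11 atoms, X11b@3, X10a′) under census-lead's labels.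

Nothing here asserts anything about any curve: the per-row inputs (`#Ш[p] = p²` EXACT and the
non-divisible class) are certificate-shaped HYPOTHESES that a class team instantiates from
instrument records (EVIDENCE tier per census-lead); the Cassels–Tate pairing enters as the tree's
named fact, exactly as in every `…_of_casselsTate_…` consumer of this directory.
-/

open scoped Classical

namespace Summit.BirchSwinnertonDyer.Rank1Residual.SecondDescent

section Algebra

variable {A : Type*} [AddCommGroup A] {C : Type*} [AddCommGroup C]

/-- In a finite additive group, an element killed by two coprime naturals is zero. -/
theorem eq_zero_of_nsmul_eq_zero_of_coprime {m n : ℕ} (hmn : Nat.Coprime m n) {v : C}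
    (hm : m • v = 0) (hn : n • v = 0) : v = 0 := by
  have h1 : addOrderOf v ∣ 1 := by
    rw [← hmn.gcd_eq_one]
    exact Nat.dvd_gcd (addOrderOf_dvd_of_nsmul_eq_zero hm) (addOrderOf_dvd_of_nsmul_eq_zero hn)
  exact AddMonoid.addOrderOf_eq_one_iff.mp (Nat.dvd_one.mp h1)

/-- The order of a `p`-power-torsion element is a power of `p`. -/
theorem addOrderOf_eq_pow_of_pow_nsmul_eq_zero {p : ℕ} (hp : p.Prime) {z : A} {K : ℕ}
    (hz : p ^ K • z = 0) : ∃ j ≤ K, addOrderOf z = p ^ j :=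
  (Nat.dvd_prime_pow hp).mp (addOrderOf_dvd_of_nsmul_eq_zero hz)

/-- **Main algebraic lemma.** A finite abelian group `A` with an ALTERNATING bi-additive pairing
`B` whose (left) kernel is trivial, with `#A[p] = p²` and ONE `p`-torsion element `c` that is not a
`p`-th multiple, has NO element of order `p²`: `p² • x = 0 → p • x = 0`. (Equivalently
`A[p^∞] = A[p] ≅ (ℤ/p)²`.) No structure theorem is used; see the module docstring for the proof. -/
theorem nsmul_eq_zero_of_sq_nsmul_eq_zero_of_alternating [Finite A] (B : A →+ A →+ C)
    (halt : ∀ x, B x x = 0) (hnd : ∀ x, (∀ y, B x y = 0) → x = 0) {p : ℕ} (hp : p.Prime)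
    (hcard : Nat.card (AddSubgroup.torsionBy A (p : ℤ)) = p ^ 2) {c : A} (hpc : p • c = 0)
    (hndiv : ∀ d : A, p • d ≠ c) (x : A) (hx : p ^ 2 • x = 0) : p • x = 0 := by
  haveI : Fact p.Prime := ⟨hp⟩
  by_contra hpx
  -- the `p`-power-torsion elements, and one of maximal order
  let P : Type _ := {a : A // ∃ K : ℕ, p ^ K • a = 0}
  haveI : Finite P := Subtype.finite
  haveI : Nonempty P := ⟨⟨0, 0, by simp⟩⟩
  obtain ⟨⟨u, Ku, hKu⟩, humax⟩ := Finite.exists_max fun a : P => addOrderOf a.1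
  obtain ⟨k, -, hk⟩ := addOrderOf_eq_pow_of_pow_nsmul_eq_zero hp hKu
  -- every `p`-power-torsion element is killed by `p ^ k`
  have hkill : ∀ z : A, ∀ K : ℕ, p ^ K • z = 0 → p ^ k • z = 0 := by
    intro z K hzK
    obtain ⟨j, -, hj⟩ := addOrderOf_eq_pow_of_pow_nsmul_eq_zero hp hzK
    have hle : addOrderOf z ≤ addOrderOf u := humax ⟨z, K, hzK⟩
    rw [hj, hk] at hle
    have hjk : j ≤ k := (Nat.pow_le_pow_iff_right hp.one_lt).mp hle
    rw [← addOrderOf_dvd_iff_nsmul_eq_zero, hj]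
    exact pow_dvd_pow p hjk
  -- `x` has order `p²`, so `k ≥ 2`
  have hx2 : addOrderOf x = p ^ 2 := by
    obtain ⟨j, hj2, hj⟩ := addOrderOf_eq_pow_of_pow_nsmul_eq_zero hp hx
    interval_cases j
    · exfalso; apply hpx
      have : x = 0 := by simpa using hj
      simp [this]
    · exfalso; apply hpx
      rw [← addOrderOf_dvd_iff_nsmul_eq_zero, hj, pow_one]
    · exact hj
  have hk2 : 2 ≤ k := by
    have hle : addOrderOf x ≤ addOrderOf u := humax ⟨x, 2, hx⟩
    rw [hx2, hk] at hle
    exact (Nat.pow_le_pow_iff_right hp.one_lt).mp hle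
  -- `y = p^(k-1) • u` is a nonzero `p`-torsion `p`-th multiple
  set y : A := p ^ (k - 1) • u with hy
  have hy0 : y ≠ 0 := by
    intro h0
    have hdvd : addOrderOf u ∣ p ^ (k - 1) := addOrderOf_dvd_of_nsmul_eq_zero h0
    rw [hk] at hdvd
    have := Nat.le_of_dvd (pow_pos hp.pos _) hdvd
    have hlt : p ^ (k - 1) < p ^ k := Nat.pow_lt_pow_right hp.one_lt (by omega)
    omega
  have hpy : p • y = 0 := by
    rw [hy, ← mul_nsmul', ← pow_succ', Nat.sub_add_cancel (by omega : 1 ≤ k), ← hk]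
    exact addOrderOf_nsmul_eq_zero u
  have hydiv : ∃ d : A, p • d = y :=
    ⟨p ^ (k - 2) • u, by rw [hy, ← mul_nsmul', ← pow_succ']; congr 2; omega⟩
  -- the subgroup `S = A[p] ∩ pA`
  let S : AddSubgroup A :=
    { carrier := {a : A | p • a = 0 ∧ ∃ d : A, p • d = a}
      zero_mem' := ⟨smul_zero _, ⟨0, smul_zero _⟩⟩
      add_mem' := by
        rintro a b ⟨ha, da, rfl⟩ ⟨hb, db, rfl⟩
        exact ⟨by rw [smul_add, ha, hb, add_zero], ⟨da + db, smul_add _ _ _⟩⟩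
      neg_mem' := by
        rintro a ⟨ha, da, rfl⟩
        exact ⟨by rw [smul_neg, ha, neg_zero], ⟨-da, smul_neg _ _⟩⟩ }
  have hyS : y ∈ S := ⟨hpy, hydiv⟩
  have hcS : c ∉ S := fun h => by obtain ⟨-, d, hd⟩ := h; exact hndiv d hd
  have hcT : c ∈ AddSubgroup.torsionBy A (p : ℤ) := by
    rw [AddSubgroup.torsionBy.nsmul_iff]; exact hpc
  have hST : S ≤ AddSubgroup.torsionBy A (p : ℤ) := by
    intro a ha; rw [AddSubgroup.torsionBy.nsmul_iff]; exact ha.1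
  have hZS : AddSubgroup.zmultiples y ≤ S := (AddSubgroup.zmultiples_le_of_mem hyS)
  -- counting: `#S ∣ p²`, `#S ≠ p²` (misses `c`), `p ∣ #S` (contains `ℤ∙y` of order `p`) ⇒ `S = ℤ∙y`
  have hoy : addOrderOf y = p := addOrderOf_eq_prime hpy hy0
  have hcardZ : Nat.card (AddSubgroup.zmultiples y) = p := by rw [Nat.card_zmultiples, hoy]
  have hSdvd : Nat.card S ∣ p ^ 2 := hcard ▸ AddSubgroup.card_dvd_of_le hST
  have hpS : p ∣ Nat.card S := hcardZ ▸ AddSubgroup.card_dvd_of_le hZS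
  have hSne : Nat.card S ≠ p ^ 2 := by
    intro hS
    have hEq : S = AddSubgroup.torsionBy A (p : ℤ) :=
      AddSubgroup.eq_of_le_of_card_ge hST (by rw [hS, hcard])
    exact hcS (hEq ▸ hcT)
  have hcardS : Nat.card S = p := by
    obtain ⟨i, hi2, hi⟩ := (Nat.dvd_prime_pow hp).mp hSdvd
    interval_cases i
    · exfalso; rw [hi, pow_zero] at hpS; exact hp.one_lt.ne' (Nat.dvd_one.mp hpS)
    · rw [hi, pow_one]
    · exact absurd hi hSne
  have hSZ : S = AddSubgroup.zmultiples y :=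
    (AddSubgroup.eq_of_le_of_card_ge hZS (by rw [hcardS, hcardZ])).symm
  -- hence `B u a = 0` for every `a ∈ S`
  have huu : B u y = 0 := by
    rw [hy, map_nsmul, halt, smul_zero]
  have huS : ∀ a ∈ S, B u a = 0 := by
    intro a ha
    rw [hSZ, AddSubgroup.mem_zmultiples_iff] at ha
    obtain ⟨t, rfl⟩ := ha
    rw [map_zsmul, huu, smul_zero]
  -- `y` pairs to zero with every `p`-power-torsion element …
  have hyz : ∀ z : A, ∀ K : ℕ, p ^ K • z = 0 → B y z = 0 := by
    intro z K hzK
    have hz : p ^ k • z = 0 := hkill z K hzK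
    have hmem : p ^ (k - 1) • z ∈ S := by
      refine ⟨?_, ⟨p ^ (k - 2) • z, ?_⟩⟩
      · rw [← mul_nsmul', ← pow_succ', Nat.sub_add_cancel (by omega : 1 ≤ k), hz]
      · rw [← mul_nsmul', ← pow_succ']; congr 2; omega
    have h1 : B y z = B u (p ^ (k - 1) • z) := by
      rw [hy, map_nsmul, AddMonoidHom.nsmul_apply, map_nsmul]
    rw [h1]; exact huS _ hmem
  -- … and therefore with every element (coprime-order bookkeeping)
  have hyw : ∀ w : A, B y w = 0 := by
    intro w
    have ho : addOrderOf w ≠ 0 := (addOrderOf_pos w).ne'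
    obtain ⟨e, m, hm, hom⟩ := Nat.exists_eq_pow_mul_and_not_dvd ho p hp.ne_one
    have hmw : p ^ e • (m • w) = 0 := by
      rw [← mul_nsmul', ← hom]; exact addOrderOf_nsmul_eq_zero w
    have h1 : m • B y w = 0 := by rw [← map_nsmul, hyz (m • w) e hmw]
    have h2 : p • B y w = 0 := by
      rw [← AddMonoidHom.nsmul_apply, ← map_nsmul, hpy, map_zero, AddMonoidHom.zero_apply]
    have hcop : Nat.Coprime m p := (Nat.coprime_comm.mp ((Nat.Prime.coprime_iff_not_dvd hp).mpr hm))
    exact eq_zero_of_nsmul_eq_zero_of_coprime hcop h1 h2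
  exact hy0 (hnd y hyw)

/-- Under the hypotheses of `nsmul_eq_zero_of_sq_nsmul_eq_zero_of_alternating` the `p²`-torsion
IS the `p`-torsion: `A[p²] = A[p]`. -/
theorem torsionBy_sq_eq_torsionBy_of_alternating [Finite A] (B : A →+ A →+ C)
    (halt : ∀ x, B x x = 0) (hnd : ∀ x, (∀ y, B x y = 0) → x = 0) {p : ℕ} (hp : p.Prime)
    (hcard : Nat.card (AddSubgroup.torsionBy A (p : ℤ)) = p ^ 2) {c : A} (hpc : p • c = 0)
    (hndiv : ∀ d : A, p • d ≠ c) :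
    AddSubgroup.torsionBy A ((p ^ 2 : ℕ) : ℤ) = AddSubgroup.torsionBy A (p : ℤ) := by
  ext x
  rw [AddSubgroup.torsionBy.nsmul_iff, AddSubgroup.torsionBy.nsmul_iff]
  constructor
  · exact nsmul_eq_zero_of_sq_nsmul_eq_zero_of_alternating B halt hnd hp hcard hpc hndiv x
  · intro h; rw [pow_succ, mul_nsmul', h, smul_zero]

/-- Under the same hypotheses `#A[p²] = p²` (the count the level-`p²` descent reads). -/
theorem card_torsionBy_sq_eq_of_alternating [Finite A] (B : A →+ A →+ C)
    (halt : ∀ x, B x x = 0) (hnd : ∀ x, (∀ y, B x y = 0) → x = 0) {p : ℕ} (hp : p.Prime)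
    (hcard : Nat.card (AddSubgroup.torsionBy A (p : ℤ)) = p ^ 2) {c : A} (hpc : p • c = 0)
    (hndiv : ∀ d : A, p • d ≠ c) :
    Nat.card (AddSubgroup.torsionBy A ((p ^ 2 : ℕ) : ℤ)) = p ^ 2 := by
  rw [torsionBy_sq_eq_torsionBy_of_alternating B halt hnd hp hcard hpc hndiv, hcard]

end Algebra

section Sha

open WeierstrassCurve Literature.NumberTheory.EllipticCurves

universe u

variable {K : Type u} [Field K] [NumberField K]

/-- **The B-1 `EMPTY` reading, kernel form.** For an elliptic curve `E/K` with FINITE `Ш(E/K)`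
(e.g. analytic rank `≤ 1` over `ℚ`), the Cassels–Tate pairing fact (`exists_casselsTate_pairing`,
Silverman *AEC* X.4.14: alternating, kernel = divisible elements, and a finite group has none),
an EXACT count `#Ш[p] = p²`, and ONE class `c ∈ Ш[p]` that is NOT a `p`-th multiple in `Ш`
(= a second-descent `EMPTY` certificate for a torsor representing `c`, Creutz 2014) give
`Ш[p²] = Ш[p]`: every `x ∈ Ш` with `p² • x = 0` has `p • x = 0`. Certificate-shaped hypotheses;
nothing about any particular curve is asserted here. -/
theorem _root_.WeierstrassCurve.sha_nsmul_eq_zero_of_sq_of_casselsTate_of_not_divisible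
    (h : exists_casselsTate_pairing (K := K)) (W : WeierstrassCurve K) [W.IsElliptic]
    [Finite W.sha] {p : ℕ} (hp : p.Prime)
    (hcard : Nat.card (AddSubgroup.torsionBy W.sha (p : ℤ)) = p ^ 2) {c : W.sha}
    (hpc : p • c = 0) (hndiv : ∀ d : W.sha, p • d ≠ c) (x : W.sha) (hx : p ^ 2 • x = 0) :
    p • x = 0 := by
  obtain ⟨B, halt, hker⟩ := h W
  refine nsmul_eq_zero_of_sq_nsmul_eq_zero_of_alternating B halt (fun a ha => ?_) hp hcard hpc
    hndiv x hx
  have hmem : a ∈ AddSubgroup.divisibleElements W.sha := (hker a).mp ha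
  rwa [divisibleElements_eq_bot_of_finite, AddSubgroup.mem_bot] at hmem

/-- **`#Ш[p²] = p²` from one non-divisible class** (same hypotheses): the level-`p²` count that,
with the descent formula `#Sel^(p²) = p^(2·rank) · #E(K)[p²] · #Ш[p²]`, yields e.g. the
`#Sel^(9)(E/ℚ) = 81` input of `X11b/Three/NineDescentCertificate.lean` on rank-one `#Ш_an = 9`
rows (there `E(ℚ)[3] = 0`). -/
theorem _root_.WeierstrassCurve.card_sha_torsionBy_sq_eq_of_casselsTate_of_not_divisible
    (h : exists_casselsTate_pairing (K := K)) (W : WeierstrassCurve K) [W.IsElliptic]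
    [Finite W.sha] {p : ℕ} (hp : p.Prime)
    (hcard : Nat.card (AddSubgroup.torsionBy W.sha (p : ℤ)) = p ^ 2) {c : W.sha}
    (hpc : p • c = 0) (hndiv : ∀ d : W.sha, p • d ≠ c) :
    Nat.card (AddSubgroup.torsionBy W.sha ((p ^ 2 : ℕ) : ℤ)) = p ^ 2 := by
  obtain ⟨B, halt, hker⟩ := h W
  refine card_torsionBy_sq_eq_of_alternating B halt (fun a ha => ?_) hp hcard hpc hndiv
  have hmem : a ∈ AddSubgroup.divisibleElements W.sha := (hker a).mp ha
  rwa [divisibleElements_eq_bot_of_finite, AddSubgroup.mem_bot] at hmem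

end Sha

end Summit.BirchSwinnertonDyer.Rank1Residual.SecondDescent
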